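import Literature.NumberTheory.NumberFields.SelmerGroupPID
import Mathlib.NumberTheory.NumberField.ClassNumber
import Mathlib.RingTheory.DedekindDomain.Factorization
import HarnessLib

/-!
# `K(S, 2)` for rings of integers with ODD class number

`Literature/NumberTheory/NumberFields/SelmerGroupPID.lean` proved Silverman's
"`b` with `ord_v(b)` even for all `v ∉ S` is an `S`-unit times a square" (AEC, proof of
Prop. VIII.1.6) for `h_K = 1`. The complete `2`-descents over the cubic fields of conductor `1339`
(`Literature/Barriers/BirchSwinnertonDyer/RankNotSumOfLocalInvariantsF3Cubic*`) need the same
statement when only `Cl(K)[2] = 0` is known, in fact when the class number `h` is ODD. PROVED here: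

* `exists_isSquare_mul_of_two_dvd_log_valuation_of_odd`: let `h_K` be odd, `D ∈ 𝓞 K`, and `G` a
  list such that every prime IDEAL containing `D` is principal, generated by a member of `G`. If
  `b ∈ Kˣ` has `ord_v(b)` even for every finite place `v` with `D ∉ v`, then `b · u · ∏ l` is a
  square in `K` for some unit `u` and some duplicate-free sublist `l` of `G`.

Proof: clear denominators; induction on the number of primes `P ∌ D` dividing `(a)`: for such a
`P`, `P^h = (π)` is principal (`[P]^h = 1`), `e = ord_P(a)` is even, `a^h = π^e a₁` with `a₁`
supported away from `P` and with even valuations off `D`, and `h` odd lets one return from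
`a^h` to `a` inside `Kˣ/Kˣ²`; when no such `P` is left, all prime factors of `(a)` are among the
`(g)`, `g ∈ G`, and an induction on the norm finishes as in the principal case.
[cite: SilvermanAEC2009, Prop. VIII.1.6 (proof)]

## References

* J. H. Silverman, *The Arithmetic of Elliptic Curves*, 2nd ed., GTM 106 (2009), Prop. VIII.1.6
  and its proof, Thm. X.1.1(c). [SilvermanAEC2009]
-/

noncomputable section

open scoped NumberField nonZeroDivisors

open NumberField IsDedekindDomain IsDedekindDomain.HeightOneSpectrum Ideal

namespace Literature.NumberTheory.NumberFields

variable {K : Type*} [Field K] [NumberField K]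

/-! ### Valuations of algebraic integers: signs and powers -/

/-- `ord_v(r) ≥ 0` for `r ∈ 𝓞 K`: `log v(r) ≤ 0`. [folklore] -/
theorem log_valuation_nonpos (v : HeightOneSpectrum (𝓞 K)) {r : 𝓞 K} (hr : r ≠ 0) :
    WithZero.log (v.valuation K (r : K)) ≤ 0 := by
  have hne : v.valuation K (r : K) ≠ 0 := (v.valuation K).ne_zero_iff.mpr (by exact_mod_cast hr)
  have h : v.valuation K (r : K) ≤ 1 := by
    rw [valuation_of_algebraMap]; exact v.intValuation_le_one r
  rwa [← WithZero.log_le_log hne one_ne_zero, WithZero.log_one] at h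

/-- `ord_v(r) > 0 ↔ r ∈ v`, i.e. `log v(r) < 0 ↔ r ∈ v`. [folklore] -/
theorem log_valuation_neg_iff_mem (v : HeightOneSpectrum (𝓞 K)) {r : 𝓞 K} (hr : r ≠ 0) :
    WithZero.log (v.valuation K (r : K)) < 0 ↔ r ∈ v.asIdeal := by
  have hne : v.valuation K (r : K) ≠ 0 := (v.valuation K).ne_zero_iff.mpr (by exact_mod_cast hr)
  rw [← intValuation_lt_one_iff_mem, ← valuation_of_algebraMap (K := K),
    ← WithZero.log_lt_log hne one_ne_zero, WithZero.log_one]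

/-- `r ∈ vⁿ ↔ log v(r) ≤ -n`. [folklore] -/
theorem mem_pow_iff_log_valuation_le (v : HeightOneSpectrum (𝓞 K)) {r : 𝓞 K} (hr : r ≠ 0)
    (n : ℕ) : r ∈ v.asIdeal ^ n ↔ WithZero.log (v.valuation K (r : K)) ≤ -(n : ℤ) := by
  have hne : v.valuation K (r : K) ≠ 0 := (v.valuation K).ne_zero_iff.mpr (by exact_mod_cast hr)
  rw [WithZero.log_le_iff_le_exp hne, valuation_of_algebraMap, intValuation_le_pow_iff_mem]

/-- A finite place containing a generator of `P^h` is `P`. [folklore] -/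
theorem heightOneSpectrum_eq_of_mem {v P : HeightOneSpectrum (𝓞 K)} {h : ℕ} {π : 𝓞 K}
    (hπ : span {π} = P.asIdeal ^ h) (hmem : π ∈ v.asIdeal) : v = P := by
  have h1 : v.asIdeal ∣ P.asIdeal ^ h := by
    rw [← hπ, dvd_span_singleton]; exact hmem
  have h2 : v.asIdeal ∣ P.asIdeal := v.prime.dvd_of_dvd_pow h1
  exact HeightOneSpectrum.ext ((P.isPrime.isMaximal P.ne_bot).eq_of_le v.isPrime.ne_top
    (le_of_dvd h2)).symm

open scoped Classical in
/-- **Valuations of a generator of `P^h`**: `log v(π) = -h` for `v = P` and `0` otherwise.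
[folklore] -/
theorem log_valuation_of_span_eq_pow {P : HeightOneSpectrum (𝓞 K)} {h : ℕ} {π : 𝓞 K}
    (hπ : span {π} = P.asIdeal ^ h) (v : HeightOneSpectrum (𝓞 K)) :
    WithZero.log (v.valuation K (π : K)) = if v = P then -(h : ℤ) else 0 := by
  have hπ0 : π ≠ 0 := by
    intro h0
    rw [h0, span_singleton_eq_bot.mpr rfl] at hπ
    exact pow_ne_zero h P.ne_bot hπ.symm
  split_ifs with hv
  · subst hv
    apply le_antisymm
    · rw [← mem_pow_iff_log_valuation_le v hπ0, ← hπ]; exact mem_span_singleton_self π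
    · by_contra hlt
      push Not at hlt
      have hle : WithZero.log (v.valuation K (π : K)) ≤ -((h + 1 : ℕ) : ℤ) := by
        push_cast; omega
      rw [← mem_pow_iff_log_valuation_le v hπ0] at hle
      have hdvd : v.asIdeal ^ h * v.asIdeal ∣ v.asIdeal ^ h * 1 := by
        rw [mul_one, ← pow_succ, ← hπ]
        exact dvd_span_singleton.mpr hle
      have h1 : v.asIdeal ∣ 1 := (mul_dvd_mul_iff_left (pow_ne_zero h v.ne_bot)).mp hdvd
      exact v.isPrime.ne_top (Ideal.isUnit_iff.mp (isUnit_of_dvd_one h1))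
  · have hnot : π ∉ v.asIdeal := fun hmem => hv (heightOneSpectrum_eq_of_mem hπ hmem)
    exact log_valuation_eq_zero_of_not_mem v hnot

/-! ### The case where every prime dividing `(a)` lies above `S` -/

/-- **All prime factors above `S`**: if every prime ideal containing `a ≠ 0` contains `D`, and
every prime ideal containing `D` is `(g)` for some `g ∈ G`, then `a · u · ∏ l` is a square for a
unit `u` and a duplicate-free sublist `l` of `G` (induction on the norm, as in the principal
case). [cite: SilvermanAEC2009, Prop. VIII.1.6 (proof)] -/
theorem exists_isSquare_mul_of_support (D : 𝓞 K) (G : List (𝓞 K))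
    (hD : ∀ v : HeightOneSpectrum (𝓞 K), D ∈ v.asIdeal → ∃ g ∈ G, v.asIdeal = span {g}) :
    ∀ (a : 𝓞 K), a ≠ 0 → (∀ v : HeightOneSpectrum (𝓞 K), a ∈ v.asIdeal → D ∈ v.asIdeal) →
      ∃ (u : (𝓞 K)ˣ) (l : List (𝓞 K)), (∀ g ∈ l, g ∈ G) ∧ l.Nodup ∧
        IsSquare ((a : K) * (u : 𝓞 K) * (l.prod : 𝓞 K)) := by
  suffices key : ∀ (n : ℕ) (a : 𝓞 K), absNorm (span {a}) = n → a ≠ 0 →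
      (∀ v : HeightOneSpectrum (𝓞 K), a ∈ v.asIdeal → D ∈ v.asIdeal) →
      ∃ (u : (𝓞 K)ˣ) (l : List (𝓞 K)), (∀ g ∈ l, g ∈ G) ∧ l.Nodup ∧
        IsSquare ((a : K) * (u : 𝓞 K) * (l.prod : 𝓞 K)) from
    fun a ha hsupp => key _ a rfl ha hsupp
  intro n
  induction n using Nat.strong_induction_on with
  | _ n ih =>
  classical
  intro a han ha hsupp
  by_cases hu : IsUnit a
  · refine ⟨hu.unit⁻¹, [], by simp, List.nodup_nil, 1, ?_⟩
    have h1 := congrArg (fun z : 𝓞 K => (z : K)) hu.mul_val_inv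
    push_cast at h1
    rw [List.prod_nil]
    push_cast
    rw [h1]
  · -- a prime ideal `P ∋ a`; it contains `D`, hence `P = (g)`
    obtain ⟨M, hMmax, haM⟩ := exists_le_maximal (span {a}) (by
      rwa [Ne, span_singleton_eq_top])
    have hM0 : M ≠ ⊥ := fun h0 => ha (by
      rw [h0, le_bot_iff, span_singleton_eq_bot] at haM; exact haM)
    set v : HeightOneSpectrum (𝓞 K) := ⟨M, hMmax.isPrime, hM0⟩ with hv
    have hav : a ∈ v.asIdeal := (span_singleton_le_iff_mem M).mp haM
    obtain ⟨g, hgG, hvg⟩ := hD v (hsupp v hav)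
    have hg : Prime g := by
      have hp := v.prime
      rw [hvg, prime_span_singleton_iff] at hp
      exact hp
    have hga : g ∣ a := by rw [← mem_span_singleton, ← hvg]; exact hav
    obtain ⟨a₁, rfl⟩ := hga
    have ha₁ : a₁ ≠ 0 := right_ne_zero_of_mul ha
    have hg0 : g ≠ 0 := left_ne_zero_of_mul ha
    -- the norm drops
    have hnormg : 1 < absNorm (span {g}) := by
      rcases Nat.lt_or_ge 1 (absNorm (span {g})) with h | h
      · exact h
      · exfalso
        interval_cases h' : absNorm (span ({g} : Set (𝓞 K)))
        · exact hg0 (span_singleton_eq_bot.mp (absNorm_eq_zero_iff.mp h'))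
        · exact hg.not_unit (span_singleton_eq_top.mp (absNorm_eq_one_iff.mp h'))
    have hlt : absNorm (span {a₁}) < n := by
      rw [← han, ← span_singleton_mul_span_singleton, map_mul]
      have h2 : 0 < absNorm (span {a₁}) := Nat.pos_of_ne_zero fun h =>
        ha₁ (span_singleton_eq_bot.mp (absNorm_eq_zero_iff.mp h))
      nlinarith
    have hsupp₁ : ∀ w : HeightOneSpectrum (𝓞 K), a₁ ∈ w.asIdeal → D ∈ w.asIdeal :=
      fun w hw => hsupp w (w.asIdeal.mul_mem_left g hw)
    obtain ⟨u, l, hlG, hnd, hsq⟩ := ih _ hlt a₁ rfl ha₁ hsupp₁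
    by_cases hgl : g ∈ l
    · refine ⟨u, l.erase g, fun x hx => hlG x (List.mem_of_mem_erase hx), hnd.erase g, ?_⟩
      have hprod : (l.prod : 𝓞 K) = g * (l.erase g).prod := (List.prod_erase hgl).symm
      rw [hprod] at hsq
      push_cast at hsq ⊢
      convert hsq using 1
      ring
    · refine ⟨u, g :: l, ?_, List.nodup_cons.mpr ⟨hgl, hnd⟩, ?_⟩
      · intro x hx
        rcases List.mem_cons.mp hx with rfl | hx
        · exact hgG
        · exact hlG x hx
      · obtain ⟨w, hw⟩ := hsq
        refine ⟨(g : K) * w, ?_⟩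
        rw [List.prod_cons]
        push_cast at hw ⊢
        linear_combination (g : K) ^ 2 * hw

/-! ### The integral case for odd class number -/

open scoped Classical in
/-- The finite set of primes `P ∌ D` dividing `(a)`. [folklore] -/
def badSupport (D a : 𝓞 K) (ha : a ≠ 0) : Finset (HeightOneSpectrum (𝓞 K)) :=
  ((Ideal.finite_factors (show span {a} ≠ (0 : Ideal (𝓞 K)) by
    rwa [zero_eq_bot, Ne, span_singleton_eq_bot])).toFinset).filter fun v => D ∉ v.asIdeal

/-- Membership in `badSupport`. [folklore] -/
theorem mem_badSupport {D a : 𝓞 K} {ha : a ≠ 0} {v : HeightOneSpectrum (𝓞 K)} :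
    v ∈ badSupport D a ha ↔ a ∈ v.asIdeal ∧ D ∉ v.asIdeal := by
  classical
  simp [badSupport, dvd_span_singleton]

/-- **The integral case, odd class number.** `h_K` odd, every prime ideal containing `D` is `(g)`
for some `g ∈ G`: every non-zero `a ∈ 𝓞 K` with `ord_v(a)` even for all `v ∌ D` is a unit times a
duplicate-free product of members of `G` times a square (induction on the number of primes `∌ D`
dividing `(a)`, through `P^h = (π)`). [cite: SilvermanAEC2009, Prop. VIII.1.6 (proof)] -/
theorem exists_isSquare_mul_of_two_dvd_log_valuation_int_of_odd (hodd : Odd (classNumber K))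
    (D : 𝓞 K) (G : List (𝓞 K))
    (hD : ∀ v : HeightOneSpectrum (𝓞 K), D ∈ v.asIdeal → ∃ g ∈ G, v.asIdeal = span {g}) :
    ∀ (a : 𝓞 K), a ≠ 0 →
      (∀ v : HeightOneSpectrum (𝓞 K), D ∉ v.asIdeal →
        (2 : ℤ) ∣ WithZero.log (v.valuation K (a : K))) →
      ∃ (u : (𝓞 K)ˣ) (l : List (𝓞 K)), (∀ g ∈ l, g ∈ G) ∧ l.Nodup ∧
        IsSquare ((a : K) * (u : 𝓞 K) * (l.prod : 𝓞 K)) := by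
  suffices key : ∀ (s : ℕ) (a : 𝓞 K) (ha : a ≠ 0), (badSupport D a ha).card = s →
      (∀ v : HeightOneSpectrum (𝓞 K), D ∉ v.asIdeal →
        (2 : ℤ) ∣ WithZero.log (v.valuation K (a : K))) →
      ∃ (u : (𝓞 K)ˣ) (l : List (𝓞 K)), (∀ g ∈ l, g ∈ G) ∧ l.Nodup ∧
        IsSquare ((a : K) * (u : 𝓞 K) * (l.prod : 𝓞 K)) from
    fun a ha hval => key _ a ha rfl hval
  intro s
  induction s using Nat.strong_induction_on with
  | _ s ih =>
  intro a ha hs hval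
  classical
  by_cases hempty : badSupport D a ha = ∅
  · -- every prime dividing `(a)` contains `D`
    refine exists_isSquare_mul_of_support D G hD a ha fun v hv => ?_
    by_contra hDv
    have : v ∈ badSupport D a ha := mem_badSupport.mpr ⟨hv, hDv⟩
    rw [hempty] at this
    exact Finset.notMem_empty v this
  · obtain ⟨P, hP⟩ := Finset.nonempty_of_ne_empty hempty
    obtain ⟨haP, hDP⟩ := mem_badSupport.mp hP
    -- `e = ord_P(a)`, even and positive
    have hneg : WithZero.log (P.valuation K (a : K)) < 0 := (log_valuation_neg_iff_mem P ha).mpr haP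
    obtain ⟨e', he'⟩ := hval P hDP
    obtain ⟨e, he⟩ : ∃ e : ℕ, WithZero.log (P.valuation K (a : K)) = -(2 * (e : ℤ)) :=
      ⟨(-e').toNat, by rw [he']; omega⟩
    -- `h = h_K` odd, `P^h = (π)`
    obtain ⟨k, hk⟩ := hodd
    set h := classNumber K with hh
    have hPh : (P.asIdeal ^ h).IsPrincipal := by
      have hP0 : P.asIdeal ∈ (Ideal (𝓞 K))⁰ := mem_nonZeroDivisors_of_ne_zero P.ne_bot
      have := (ClassGroup.mk0_eq_one_iff (pow_mem hP0 h)).mp (by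
        rw [show (⟨P.asIdeal ^ h, pow_mem hP0 h⟩ : (Ideal (𝓞 K))⁰) =
          ⟨P.asIdeal, hP0⟩ ^ h from Subtype.ext (by rw [SubmonoidClass.coe_pow]), map_pow,
          hh, classNumber, pow_card_eq_one])
      exact this
    obtain ⟨π, hπ⟩ : ∃ π : 𝓞 K, span {π} = P.asIdeal ^ h :=
      ⟨hPh.generator, by rw [Ideal.span_singleton_generator]⟩
    have hπ0 : π ≠ 0 := by
      intro h0
      rw [h0, span_singleton_eq_bot.mpr rfl] at hπ
      exact pow_ne_zero h P.ne_bot hπ.symm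
    have hlogπ := log_valuation_of_span_eq_pow (K := K) hπ
    -- `π^(2e) ∣ a^h`
    have hdvd : π ^ (2 * e) ∣ a ^ h := by
      rw [← mem_span_singleton, ← span_singleton_pow, hπ, ← pow_mul,
        mem_pow_iff_log_valuation_le P (pow_ne_zero h ha)]
      push_cast
      rw [map_pow, WithZero.log_pow, he]
      simp only [nsmul_eq_mul]
      nlinarith
    obtain ⟨a₁, ha₁⟩ := hdvd
    have ha₁0 : a₁ ≠ 0 := by
      rintro rfl
      rw [mul_zero] at ha₁
      exact pow_ne_zero h ha ha₁
    -- valuations of `a₁`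
    have hloga₁ : ∀ v : HeightOneSpectrum (𝓞 K), WithZero.log (v.valuation K (a₁ : K)) =
        h * WithZero.log (v.valuation K (a : K)) -
          2 * e * WithZero.log (v.valuation K (π : K)) := by
      intro v
      have hne : ∀ {r : 𝓞 K}, r ≠ 0 → v.valuation K (r : K) ≠ 0 := fun hr =>
        (v.valuation K).ne_zero_iff.mpr (by exact_mod_cast hr)
      have key := congrArg (fun r : 𝓞 K => WithZero.log (v.valuation K (r : K))) ha₁
      push_cast at key
      rw [map_pow, map_mul, map_pow, WithZero.log_pow, WithZero.log_mul (pow_ne_zero _ (hne hπ0))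
        (hne ha₁0), WithZero.log_pow] at key
      simp only [nsmul_eq_mul] at key
      push_cast at key
      linarith
    -- the bad support shrinks
    have hsub : badSupport D a₁ ha₁0 ⊆ (badSupport D a ha).erase P := by
      intro v hv
      obtain ⟨hav, hDv⟩ := mem_badSupport.mp hv
      have hlt := (log_valuation_neg_iff_mem v ha₁0).mpr hav
      rw [hloga₁ v, hlogπ v] at hlt
      rw [Finset.mem_erase, mem_badSupport]
      refine ⟨fun hvP => ?_, ?_, hDv⟩
      · rw [if_pos hvP, hvP, he] at hlt
        nlinarith
      · split_ifs at hlt with hvP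
        · rw [hvP, he] at hlt; nlinarith
        · rw [mul_zero, sub_zero] at hlt
          have hcl : 0 < (h : ℤ) := by rw [hk]; omega
          exact (log_valuation_neg_iff_mem v ha).mp (by nlinarith)
    have hcard : (badSupport D a₁ ha₁0).card < s := by
      calc (badSupport D a₁ ha₁0).card ≤ ((badSupport D a ha).erase P).card :=
            Finset.card_le_card hsub
        _ < (badSupport D a ha).card := Finset.card_erase_lt_of_mem hP
        _ = s := hs
    -- parity for `a₁`
    have hval₁ : ∀ v : HeightOneSpectrum (𝓞 K), D ∉ v.asIdeal →
        (2 : ℤ) ∣ WithZero.log (v.valuation K (a₁ : K)) := by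
      intro v hDv
      rw [hloga₁ v]
      obtain ⟨c, hc⟩ := hval v hDv
      rw [hc]
      exact Dvd.dvd.sub ⟨h * c, by ring⟩ ⟨e * WithZero.log (v.valuation K (π : K)), by ring⟩
    obtain ⟨u, l, hlG, hnd, w, hw⟩ := ih _ hcard a₁ ha₁0 rfl hval₁
    refine ⟨u, l, hlG, hnd, (π : K) ^ e * w / (a : K) ^ k, ?_⟩
    have ha0 : (a : K) ≠ 0 := by exact_mod_cast ha
    have hak : (a : K) ^ k ≠ 0 := pow_ne_zero k ha0
    have key : ((a : K)) ^ (2 * k + 1) = (π : K) ^ (2 * e) * a₁ := by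
      rw [← hk]; exact_mod_cast ha₁
    rw [div_mul_div_comm, eq_div_iff (mul_ne_zero hak hak)]
    linear_combination ((u : 𝓞 K) * (l.prod : 𝓞 K) : K) * key + (π : K) ^ (2 * e) * hw

/-- **`K(S, 2)` is spanned by units and the primes above `S` when `h_K` is odd.** Let the class
number of `K` be odd, `D ∈ 𝓞 K`, and `G` a list such that every prime ideal containing `D` is
`(g)` for some `g ∈ G`. If `b ∈ Kˣ` has `ord_v(b) ≡ 0 (mod 2)` for every finite place `v` with
`D ∉ v` (`b̄ ∈ K(S, 2)`, `S` the places dividing `D`), then `b · u · ∏ l` is a square in `K` for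
some unit `u ∈ (𝓞 K)ˣ` and some duplicate-free sublist `l` of `G`. (Silverman, proof of
Prop. VIII.1.6, with "`R_S` principal" weakened to "`Cl(R)` of odd order and the primes of `S`
principal".) [cite: SilvermanAEC2009, Prop. VIII.1.6 (proof)] -/
theorem exists_isSquare_mul_of_two_dvd_log_valuation_of_odd (hodd : Odd (classNumber K))
    (D : 𝓞 K) (G : List (𝓞 K))
    (hD : ∀ v : HeightOneSpectrum (𝓞 K), D ∈ v.asIdeal → ∃ g ∈ G, v.asIdeal = span {g})
    {b : K} (hb : b ≠ 0)
    (hval : ∀ v : HeightOneSpectrum (𝓞 K), D ∉ v.asIdeal →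
      (2 : ℤ) ∣ WithZero.log (v.valuation K b)) :
    ∃ (u : (𝓞 K)ˣ) (l : List (𝓞 K)), (∀ g ∈ l, g ∈ G) ∧ l.Nodup ∧
      IsSquare (b * (u : 𝓞 K) * (l.prod : 𝓞 K)) := by
  obtain ⟨x, y, hy, hxy⟩ := IsFractionRing.div_surjective (A := 𝓞 K) b
  have hy0 : y ≠ 0 := nonZeroDivisors.ne_zero hy
  have hy0' : (y : K) ≠ 0 := by exact_mod_cast hy0
  have hx0 : x ≠ 0 := by
    rintro rfl
    rw [map_zero, zero_div] at hxy
    exact hb hxy.symm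
  have ha : ((x * y : 𝓞 K) : K) = b * (y : K) ^ 2 := by
    rw [← hxy]; push_cast; field_simp
  have hval' : ∀ v : HeightOneSpectrum (𝓞 K), D ∉ v.asIdeal →
      (2 : ℤ) ∣ WithZero.log (v.valuation K ((x * y : 𝓞 K) : K)) := by
    intro v hv
    rw [ha]
    refine (two_dvd_log_valuation_mul_iff v hb (pow_ne_zero 2 hy0') ?_).mpr (hval v hv)
    rw [map_pow, WithZero.log_pow]
    exact ⟨_, by rw [two_nsmul, two_mul]⟩
  obtain ⟨u, l, hlG, hnd, w, hw⟩ := exists_isSquare_mul_of_two_dvd_log_valuation_int_of_odd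
    hodd D G hD (x * y) (mul_ne_zero hx0 hy0) hval'
  refine ⟨u, l, hlG, hnd, w / y, ?_⟩
  rw [ha] at hw
  field_simp
  linear_combination hw

end Literature.NumberTheory.NumberFields

end
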